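import Summits.HubbardSuperconductivity.HubbardSuperconductivity.Theorems.AnisotropyChordTransferFibre3N1Row
import Summits.HubbardSuperconductivity.HubbardSuperconductivity.Theorems.AnisotropyChordTransferFibre3B1Weighted
import Summits.HubbardSuperconductivity.HubbardSuperconductivity.Theorems.AnisotropyChordTransferFibre3B1Instances

/-!
# Route `AnisotropyChord` / H0 rotor rung, LEVEL 2 row `N₁` (PartN41-B §3): the NAMED-SUM BRACKETS proved

PORT PartN41-B (`…Fibre3N1Row`, theory-1 g22, memo 22 §333–§336) names the eleven one- and two-propagator sums of the `N₁` row
as instances of `B1.torSum` and records their L-uniform brackets at `θ₀ = 2π/128`, `K = 32` (`NamedSumBrackets`) and the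
cos-weighted convolution bracket `TxBracket` (`K = 32`, `K′ = 30`).  This file discharges both:
* `namedSumBrackets_holds : NamedSumBrackets` — ten instances of `B1.b1Bracket` (`…Fibre3B1Bracket`);
* `txBracket_holds : TxBracket` — `B1.b1Bracket_weighted` (`…Fibre3B1Weighted`) with the weight
  `w(p) = cos(θ(p₁ − q₁/2))` (`|w| ≤ 1`; on the window `w ≥ cos(θ₀|p₁ − ½|) ≥ 0` since `θ ≤ θ₀`, `θ₀·31.5 ≤ π/2`), after
  rewriting `Tx(q) = Σ_p g(p) g(p + (−q)) w(p)` (`B1.gres_neg`, `B1.toTor_neg`).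
Prover seat `hubbard-h0-rotor-p2` g4; helper for piece A = stmt-HubbardSuperconductivity-23918 of rung 19089
(`--supports`, helper class).  Nothing here proves superconductivity in the Hubbard model; helper lemmas of ONE conditional
reduction (the GM₃ ∀L certificate, Level-2 row `N₁`); the rotor TARGET as originally worded stays FALSE (g15 verdict).
Mathlib + the tree only; no sorry.
-/

set_option linter.dupNamespace false
set_option autoImplicit false

noncomputable section

open scoped BigOperators

namespace Summit.HubbardSuperconductivity.HubbardSuperconductivity.Theorems.AnisotropyChord.Transfer.Fibre3

/-! ## The scales at `L₀ = 128` -/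

/-- `2π/L ≤ 2π/128` for `L ≥ 128`, and `(2π/128)·32 ≤ π/2`, `(2π/128)·31 ≤ π/2`. [folklore] -/
theorem scales_128 (L : ℕ) (hL : 128 ≤ L) :
    2 * Real.pi / L ≤ 2 * Real.pi / 128 ∧ 2 * Real.pi / 128 * ((32 : ℕ) : ℝ) ≤ Real.pi / 2 ∧
      2 * Real.pi / 128 * ((31 : ℕ) : ℝ) ≤ Real.pi / 2 := by
  have hpi := Real.pi_pos
  have hLR : (128 : ℝ) ≤ L := by exact_mod_cast hL
  refine ⟨div_le_div_of_nonneg_left (by positivity) (by norm_num) hLR, ?_, ?_⟩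
  · push_cast; linarith
  · push_cast; linarith

/-! ## §3(a) The ten plain named sums -/

/-- ★ **`NamedSumBrackets` holds** (PartN41-B §3): the L-uniform brackets of `S₂, S₃, S₄, T10, T11, G21, G12, G22, G31, G13`
at `θ₀ = 2π/128`, `K = 32`, for every `L ≥ 128` and `0 ≤ ν < 4/π²` — ten instances of `B1.b1Bracket`. -/
theorem namedSumBrackets_holds : NamedSumBrackets := by
  intro L _ hL ν hν0 hν
  obtain ⟨hθ0, hθ0K, -⟩ := scales_128 L hL
  refine ⟨?_, ?_, ?_, ?_, ?_, ?_, ?_, ?_, ?_, ?_⟩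
  · exact B1.b1Bracket L (2 * Real.pi / 128) 32 0 _ _ 2 (by decide) (by decide) (by norm_num) (by decide)
      (by norm_num) hθ0 hθ0K ν hν0 hν
  · exact B1.b1Bracket L (2 * Real.pi / 128) 32 0 _ _ 3 (by decide) (by decide) (by norm_num) (by decide)
      (by norm_num) hθ0 hθ0K ν hν0 hν
  · exact B1.b1Bracket L (2 * Real.pi / 128) 32 0 _ _ 4 (by decide) (by decide) (by norm_num) (by decide)
      (by norm_num) hθ0 hθ0K ν hν0 hν
  · exact B1.b1Bracket L (2 * Real.pi / 128) 32 1 _ _ 2 (by decide) (by decide) (by norm_num) (by decide)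
      (by norm_num) hθ0 hθ0K ν hν0 hν
  · exact B1.b1Bracket L (2 * Real.pi / 128) 32 1 _ _ 2 (by decide) (by decide) (by norm_num) (by decide)
      (by norm_num) hθ0 hθ0K ν hν0 hν
  · exact B1.b1Bracket L (2 * Real.pi / 128) 32 1 _ _ 3 (by decide) (by decide) (by norm_num) (by decide)
      (by norm_num) hθ0 hθ0K ν hν0 hν
  · exact B1.b1Bracket L (2 * Real.pi / 128) 32 1 _ _ 3 (by decide) (by decide) (by norm_num) (by decide)
      (by norm_num) hθ0 hθ0K ν hν0 hν
  · exact B1.b1Bracket L (2 * Real.pi / 128) 32 1 _ _ 4 (by decide) (by decide) (by norm_num) (by decide)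
      (by norm_num) hθ0 hθ0K ν hν0 hν
  · exact B1.b1Bracket L (2 * Real.pi / 128) 32 1 _ _ 4 (by decide) (by decide) (by norm_num) (by decide)
      (by norm_num) hθ0 hθ0K ν hν0 hν
  · exact B1.b1Bracket L (2 * Real.pi / 128) 32 1 _ _ 4 (by decide) (by decide) (by norm_num) (by decide)
      (by norm_num) hθ0 hθ0K ν hν0 hν

/-! ## §3(b) The cos-weighted convolution `Tx(q)` -/

/-- a shifted-phase reading of `cos` through `ZMod.val`: `cos(2π·val(z)/L − c) = cos(2π z/L − c)`. [folklore] -/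
theorem cos_two_pi_val_intCast_sub (L : ℕ) [NeZero L] (z : ℤ) (c : ℝ) :
    Real.cos (2 * Real.pi * (((z : ZMod L)).val : ℝ) / L - c) = Real.cos (2 * Real.pi * (z : ℝ) / L - c) := by
  have hL : (L : ℝ) ≠ 0 := by exact_mod_cast NeZero.ne L
  have h1 : ((((z : ZMod L)).val : ℕ) : ℤ) = z % (L : ℤ) := ZMod.val_intCast z
  have h2 : (((z : ZMod L)).val : ℝ) = ((z % (L : ℤ) : ℤ) : ℝ) := by
    have := congrArg (fun t : ℤ => (t : ℝ)) h1
    simpa using this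
  set w : ℤ := z / (L : ℤ) with hw
  rw [h2, Int.emod_def, ← hw]
  push_cast
  have e : 2 * Real.pi * ((z : ℝ) - (L : ℝ) * (w : ℝ)) / L - c = (2 * Real.pi * (z : ℝ) / L - c) - (w : ℝ) * (2 * Real.pi) := by
    field_simp
    ring
  rw [e, Real.cos_periodic.sub_int_mul_eq]

/-- `Tx(q)` as a weighted two-factor B1 sum with shift `−q`. [folklore] -/
theorem txSum_eq_weighted (L : ℕ) [NeZero L] (lam2 : ℝ) (q : ℤ × ℤ) :
    TxSum L lam2 q
      = ∑ p : Tor L, (∏ i, gres L lam2 (p + B1.toTor L (![((0 : ℤ × ℤ)), -q] i)) ^ (![1, 1] : Fin 2 → ℕ) i)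
          * Real.cos (2 * Real.pi * p.1.val / L - Real.pi * q.1 / L) := by
  unfold TxSum
  refine Finset.sum_congr rfl fun p _ => ?_
  rw [Fin.prod_univ_two]
  simp only [Matrix.cons_val_zero, Matrix.cons_val_one, pow_one, B1.toTor_zero, add_zero]
  rw [← B1.gres_neg L lam2 (B1.toTor L q - p), neg_sub, sub_eq_add_neg, B1.toTor_neg]

/-- the WEIGHTED bracket of `Tx(q)` for a symbolic window: `θ = 2π/L ≤ θ₀`, `θ₀K ≤ π/2`, `K ≥ 4`, `q₁ = 1`, `|q₂| ≤ 1`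
(on the window both `p` and `p − q` have `|·|∞ ≤ K`, so `|p₁ − ½| ≤ K − ½` and the window weight is `≥ cos(θ₀(K − ½)) ≥ 0`). -/
theorem txBracket_of (L : ℕ) [NeZero L] (θ0 : ℝ) (K : ℕ) (hK : 4 ≤ K) (hθ0 : 2 * Real.pi / L ≤ θ0)
    (hθ0K' : θ0 * K ≤ Real.pi / 2) (ν : ℝ) (hν0 : 0 ≤ ν) (hν : ν < 4 / Real.pi ^ 2)
    (q : ℤ × ℤ) (hq1 : q.1 = 1 ∧ q.2.natAbs ≤ 1) :
    loSumTx ν θ0 K q - B1.tailConst ν (K - 2 * 1) 2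
        ≤ (2 * Real.pi / L) ^ (2 * 2) * TxSum L (ν * (2 * Real.pi / L) ^ 2) q ∧
      (2 * Real.pi / L) ^ (2 * 2) * TxSum L (ν * (2 * Real.pi / L) ^ 2) q
        ≤ B1.hiSum ν θ0 K 1 ![((0 : ℤ × ℤ)), -q] ![1, 1] + B1.tailConst ν (K - 2 * 1) 2 := by
  have hpi := Real.pi_pos
  have hLpos : (0 : ℝ) < L := by exact_mod_cast Nat.pos_of_ne_zero (NeZero.ne L)
  have hθpos : 0 < 2 * Real.pi / L := by positivity
  have hθ0pos : 0 < θ0 := lt_of_lt_of_le hθpos hθ0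
  have hKR : (4 : ℝ) ≤ K := by exact_mod_cast hK
  have hS : ∀ i : Fin 2, ((![((0 : ℤ × ℤ)), -q] i).1).natAbs ≤ 1 ∧ ((![((0 : ℤ × ℤ)), -q] i).2).natAbs ≤ 1 := by
    rw [Fin.forall_fin_two]
    simp only [Matrix.cons_val_zero, Matrix.cons_val_one, Prod.fst_zero, Prod.snd_zero, Int.natAbs_zero,
      zero_le, and_self, true_and, Prod.fst_neg, Prod.snd_neg, Int.natAbs_neg]
    exact ⟨by rw [hq1.1]; decide, hq1.2⟩
  -- the weights
  set w : Tor L → ℝ := fun p => Real.cos (2 * Real.pi * p.1.val / L - Real.pi * q.1 / L) with hw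
  set wlo : ℤ × ℤ → ℝ := fun p => Real.cos (θ0 * |(p.1 : ℝ) - (q.1 : ℝ) / 2|) with hwlo
  have hw1 : ∀ k, |w k| ≤ 1 := fun k => by rw [hw]; exact Real.abs_cos_le_one _
  have hq1R : (q.1 : ℝ) = 1 := by exact_mod_cast hq1.1
  have hjb : ∀ p ∈ B1.idx K 1 ![((0 : ℤ × ℤ)), -q], |(p.1 : ℝ) - (q.1 : ℝ) / 2| ≤ (K : ℝ) - 1 / 2 := by
    intro p hp
    have hp0 : p ∈ zWindow K := by simpa using ((B1.mem_idx_iff K 1 _ p).1 hp).2 0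
    have hp1 : p + -q ∈ zWindow K := by simpa using ((B1.mem_idx_iff K 1 _ p).1 hp).2 1
    obtain ⟨-, ⟨h1a, h1b⟩, -⟩ := (B1.mem_zWindow_iff K p).1 hp0
    obtain ⟨-, ⟨h2a, h2b⟩, -⟩ := (B1.mem_zWindow_iff K (p + -q)).1 hp1
    simp only [Prod.fst_add, Prod.fst_neg, hq1.1] at h2a h2b
    rw [hq1R, abs_le]
    constructor
    · have : (-(K : ℤ) + 1 : ℝ) ≤ (p.1 : ℝ) := by exact_mod_cast (show -(K : ℤ) + 1 ≤ p.1 by omega)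
      push_cast at this
      linarith
    · have : (p.1 : ℝ) ≤ (K : ℝ) := by exact_mod_cast h1b
      linarith
  have hwlo0 : ∀ p ∈ B1.idx K 1 ![((0 : ℤ × ℤ)), -q], 0 ≤ wlo p := by
    intro p hp
    rw [hwlo]
    apply Real.cos_nonneg_of_neg_pi_div_two_le_of_le
    · have : 0 ≤ θ0 * |(p.1 : ℝ) - (q.1 : ℝ) / 2| := by positivity
      linarith
    · have := hjb p hp
      nlinarith [abs_nonneg ((p.1 : ℝ) - (q.1 : ℝ) / 2)]
  have hwlo_le : ∀ p ∈ B1.idx K 1 ![((0 : ℤ × ℤ)), -q], wlo p ≤ w (B1.toTor L p) := by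
    intro p hp
    have hj := hjb p hp
    rw [hwlo, hw]
    dsimp only
    unfold B1.toTor
    dsimp only
    rw [cos_two_pi_val_intCast_sub L p.1 (Real.pi * q.1 / L)]
    have e : 2 * Real.pi * (p.1 : ℝ) / L - Real.pi * (q.1 : ℝ) / L = 2 * Real.pi / L * ((p.1 : ℝ) - (q.1 : ℝ) / 2) := by
      field_simp
    rw [e, ← Real.cos_abs (2 * Real.pi / L * _), abs_mul, abs_of_pos hθpos]
    apply Real.cos_le_cos_of_nonneg_of_le_pi (by positivity)
    · nlinarith [abs_nonneg ((p.1 : ℝ) - (q.1 : ℝ) / 2)]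
    · exact mul_le_mul_of_nonneg_right hθ0 (abs_nonneg _)
  have key := B1.b1Bracket_weighted L θ0 K 1 ![((0 : ℤ × ℤ)), -q] ![1, 1] 2
    (by decide) (by decide) (by norm_num) hS (by omega) hθ0 hθ0K' ν hν0 hν w wlo hw1 hwlo0 hwlo_le
  rw [← txSum_eq_weighted] at key
  have elo : (∑ p ∈ B1.idx K 1 ![((0 : ℤ × ℤ)), -q],
      (∏ i, (1 / (B1.nsq (p + ![((0 : ℤ × ℤ)), -q] i) - ν)) ^ (![1, 1] : Fin 2 → ℕ) i) * wlo p)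
      = loSumTx ν θ0 K q := by
    unfold loSumTx
    refine Finset.sum_congr rfl fun p _ => ?_
    rw [Fin.prod_univ_two, hwlo]
    simp only [Matrix.cons_val_zero, Matrix.cons_val_one, pow_one, add_zero, ← sub_eq_add_neg]
  rw [elo] at key
  exact key

/-- ★ **`TxBracket` holds** (PartN41-B §3): for `L ≥ 128`, `0 ≤ ν < 4/π²`, `q ∈ {(1,0), (1,1)}`:
`loSumTx ν θ₀ 32 q − tailConst ν 30 2 ≤ θ⁴·Tx(q) ≤ hiSum ν θ₀ 32 1 ![0, −q] ![1,1] + tailConst ν 30 2`, `θ₀ = 2π/128`. -/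
theorem txBracket_holds : TxBracket := by
  intro L _ hL ν hν0 hν q hq
  obtain ⟨hθ0, hθ0K', -⟩ := scales_128 L hL
  have hq1 : q.1 = 1 ∧ q.2.natAbs ≤ 1 := by
    simp only [List.mem_cons, List.not_mem_nil, or_false] at hq
    rcases hq with rfl | rfl <;> decide
  exact txBracket_of L (2 * Real.pi / 128) 32 (by norm_num) hθ0 hθ0K' ν hν0 hν q hq1

end Summit.HubbardSuperconductivity.HubbardSuperconductivity.Theorems.AnisotropyChord.Transfer.Fibre3

end
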